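import Literature.Barriers.Parity.EuclideanProofs
import Literature.NumberTheory.GaloisRepresentations.ChebotarevCyclotomic
import Literature.NumberTheory.GaloisRepresentations.CyclotomicDirichletDensity
import Literature.NumberTheory.GaloisRepresentations.FrobeniusDensityTheorem
import Literature.NumberTheory.LFunctions.DegreeOnePrimesExactCount
import Literature.NumberTheory.LFunctions.RayClassLSeriesAtOneLimitProofs
import HarnessLib

/-!
# Murty's impossibility theorem for Euclidean proofs, from Chebotarev's theorem for `K(ζ_m)/K`

Topic `Literature/Barriers/Parity`, sibling of `EuclideanProofs.lean` (the catalogue entry: Murty's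
theorem `EuclideanProofBarrier`, proved there from the named fact `PrimeDivisorClassesSubgroup`).
This file PROVES `PrimeDivisorClassesSubgroup` — Pollack's Theorem 2 / Conrad's Theorem 4: for `f`
irreducible over `ℚ` the set `S(f, m)` of classes `mod m` containing infinitely many prime divisors
of `f` is the image of a subgroup of `(ℤ/mℤ)ˣ` — and hence `EuclideanProofBarrier`, from ONE input,
the tree's named fact `Literature.NumberTheory.GaloisRepresentations.chebotarev_cyclotomicExtension`
(Chebotarev's density theorem for the cyclotomic extension `K(ζ_m)/K` of a number field,
existence form for primes of absolute degree one). Everything else is proved; no new named fact.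

The architecture is Murty–Thain's proof of their Theorem 7 (§3, p. 255): "Let `K` be the field
obtained from `ℚ` by adjoining a root of `f`. Let `L` denote the compositum of `ℚ(ζ)` and `K` …
`Gal(L/K)` injects into `Gal(ℚ(ζ)/H_l)` … By the Chebotarev density theorem, there are infinitely
many prime ideals of `K` of degree one whose Frobenius automorphism is any given conjugacy class
of our Galois group … [hence] whose Frobenius automorphism restricts to any given element",
combined with Dedekind's theorem (§2, proof of Theorem 3: "except for a finite number of
exceptions, `p` is a prime divisor of `f` exactly when `p` has a first degree prime ideal factor in
the field `ℚ(α)`"). Concretely, with `K = ℚ[X]/(f)` (the tree's `DegreeOnePrimes.RootField f`),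
`N = K(ζ_m)` (Mathlib's `CyclotomicField m K`) and `χ : Gal(N/K) → (ℤ/mℤ)ˣ` the restriction map
`σ ↦ a`, `σ ζ_m = ζ_m^a` (Mathlib's `IsPrimitiveRoot.autToPow` at `IsCyclotomicExtension.zeta`,
injective by `IsPrimitiveRoot.autToPow_injective`; no new definition is introduced):

* `card_absNorm_eq_card_range_filter`, `exists_absNorm_eq_of_isPrimeDivisorOf`,
  `isPrimeDivisorOf_of_absNorm_eq` — Dedekind: for `p ∤ lc(f) · D_f` (the tree's exact
  Dedekind–Kummer count `DegreeOnePrimes.idealNormCount_rootField_eq_card_roots`), `p` is a prime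
  divisor of `f` iff `𝓞 K` has an ideal of norm `p`;
* `cast_autToPow_eq_of_isArithFrobAt` — if `𝔮 ⊂ 𝓞 K` has prime norm `p ∤ m` and
  `φ ∈ Gal(N/K)` is an arithmetic Frobenius at a prime `𝔔 ∣ 𝔮` of `𝓞 N`, then `φ ζ_m = ζ_m^p`
  (Mathlib's `AlgHom.IsArithFrobAt.apply_of_pow_eq_one`), i.e. `χ(φ) = p mod m`;
* `primeDivisorClasses_subset_image` — UNCONDITIONALLY `S(f, m) ⊆ χ(Gal(N/K))`;
  `image_subset_primeDivisorClasses` — `χ(Gal(N/K)) ⊆ S(f, m)` granted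
  `chebotarev_cyclotomicExtension`; `primeDivisorClasses_eq_image` — equality;
* `primeDivisorClassesSubgroup_of_chebotarev`, `euclideanProofBarrier_of_chebotarev` — the named
  fact of `EuclideanProofs.lean` and Murty's theorem, granted `chebotarev_cyclotomicExtension`.

So the trust base of the catalogue entry `EuclideanProofBarrier` is reduced to Chebotarev's theorem
for cyclotomic extensions, which the tree has meanwhile PROVED through the regularity of ray class
`L`-series at `s = 1`: `chebotarev_cyclotomicExtension_of_rayClassLSeries_tendsto`
(`GaloisRepresentations/CyclotomicDirichletDensity.lean`: Dirichlet's theorem for `K(ζ_m)/K` from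
Heilbronn's (b)) applied to `Literature.NumberTheory.LFunctions.rayClassLSeries_tendsto_nhdsGT_one_holds`
(`LFunctions/RayClassLSeriesAtOneLimitProofs.lean`: Heilbronn's (b) from Weber's estimate by partial
summation).  The last section of this file composes these:

* `PrimeDivisorClassesSubgroup_holds`, `EuclideanProofBarrier_holds` — **the two named facts of
  `EuclideanProofs.lean`, DISCHARGED unconditionally** (axioms `propext`, `Classical.choice`,
  `Quot.sound`).

## What the source prints (verified on the page, Project Euclid open copy)

M. R. Murty, N. Thain, *Prime numbers in certain arithmetic progressions*, Funct. Approx. Comment.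
Math. 35 (2006), 249–259 [cite: MurtyThain2006, Theorem 1 (p. 250), §2 Theorems 2–6, §3 Theorem 7 (p. 255)].
p. 250: "Theorem 1. (Murty) A 'Euclidean proof' exists for the arithmetic progression `l (mod k)`
if and only if `l² ≡ 1 (mod k)`." pp. 250–251 (the definition): "the first requirement of a
'Euclidean proof' for the arithmetic progression `l (mod k)` is the existence of a polynomial with
infinitely many prime divisors `≡ l (mod k)` … the most reasonable definition of a Euclidean proof
… is the existence of a polynomial `f ∈ ℤ[x]` such that all prime divisors of `f` (apart from
finitely many) are either `≡ 1 (mod k)` or `l (mod k)`. We may also suppose that this polynomial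
is irreducible." p. 255: "Theorem 7. (Murty) Let `f ∈ ℤ[x]`. Suppose that with finitely many
exceptions, all prime divisors of `f` are either `≡ 1` or `l (mod k)`. Then `l² ≡ 1 (mod k)`",
proved with Bauer's theorem and "the Chebotarev density theorem [11]" as quoted above; "In
particular, there are infinitely many prime divisors of `f` which are `≡ l² (mod k)`. This forces
`l² ≡ 1` or `l (mod k)`. Hence, `l² ≡ 1 (mod k)` since `(l, k) = 1`." NOTE: as printed, Theorem 7
omits the clause "infinitely many prime divisors `≡ l (mod k)`", which its proof uses ("because `K`
has, by hypothesis infinitely many prime ideals of degree one whose norms are `≡ l (mod k)`") and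
which the definition on p. 250 contains; without it the statement is false (`f = Φ₅`, `l = 2`,
`k = 5`). The tree's `EuclideanProofBarrier` carries the clause (`IsEuclideanPolynomial`), i.e. it
is Theorem 1 ("only if") with the printed definition — faithful, not mis-stated.

## Design notes

* No reduction to a monic polynomial is needed: the tree's `DegreeOnePrimesExactCount` gives the
  Dedekind–Kummer count for `ℚ[X]/(f)` with `f` non-monic, with the explicit exceptional set
  `{p : p ∣ lc(f) · D_f}` (`D_f = DegreeOnePrimes.tailDiscr f ≠ 0`).
* Frobenius bookkeeping: Mathlib's `IsArithFrobAt`, `Ideal.LiesOver`, `Ideal.absNorm` and the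
  tree's `GaloisRepresentations.exists_isArithFrobAt_ringOfIntegers`; unramifiedness is not used.
* NOT here: Chebotarev's theorem itself; Schur's converse; Pollack's conditional Theorem 1.
-/

open Polynomial NumberField
open Literature.NumberTheory.LFunctions (idealNormCount_def)
open Literature.NumberTheory.LFunctions.DegreeOnePrimes

namespace Literature.Barriers.Parity

/-! ### Dedekind: prime divisors of `f` are the primes below an ideal of norm `p` of `ℚ[X]/(f)` -/

section RootField

variable (f : ℤ[X]) [Fact (Irreducible (f.map (algebraMap ℤ ℚ)))]

/-- **Dedekind–Kummer count, residue form.** For `f` irreducible over `ℚ`, `K = ℚ[X]/(f)`, and a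
prime `p ∤ lc(f) · D_f`, the number of ideals of `𝓞 K` of norm `p` is the number of residues
`n mod p` with `p ∣ f(n)` (the tree's `idealNormCount_rootField_eq_card_roots` and
`card_roots_toFinset_eq_card_range_filter`). [folklore] -/
theorem card_absNorm_eq_card_range_filter {p : ℕ} (hp : p.Prime)
    (hpa : ¬ p ∣ f.leadingCoeff.natAbs) (hpD : ¬ p ∣ (tailDiscr f).natAbs) :
    Nat.card {I : Ideal (𝓞 (RootField f)) // Ideal.absNorm I = p} =
      Finset.card ((Finset.range p).filter fun n : ℕ => (p : ℤ) ∣ f.eval (n : ℤ)) := by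
  haveI := Fact.mk hp
  have h0 : f.map (Int.castRingHom (ZMod p)) ≠ 0 := by
    intro h
    apply hpa
    have hc := congrArg (fun q => q.coeff f.natDegree) h
    simp only [coeff_map, coeff_natDegree, eq_intCast, coeff_zero] at hc
    rw [← Int.natCast_dvd]
    exact (ZMod.intCast_zmod_eq_zero_iff_dvd _ p).mp hc
  rw [← idealNormCount_def, idealNormCount_rootField_eq_card_roots f hpa hpD,
    card_roots_toFinset_eq_card_range_filter f h0]

/-- **Dedekind's theorem, forward** (Murty–Thain: "except for a finite number of exceptions,
`p` is a prime divisor of `f` exactly when `p` has a first degree prime ideal factor in the field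
`ℚ(α)`"): a prime divisor `p ∤ lc(f) · D_f` of `f` lies below an ideal of norm `p` of `𝓞 K`,
`K = ℚ[X]/(f)`. [cite: MurtyThain2006, §2 (proof of Theorem 3)] -/
theorem exists_absNorm_eq_of_isPrimeDivisorOf {p : ℕ} (hpa : ¬ p ∣ f.leadingCoeff.natAbs)
    (hpD : ¬ p ∣ (tailDiscr f).natAbs) (hpd : IsPrimeDivisorOf f p) :
    ∃ I : Ideal (𝓞 (RootField f)), Ideal.absNorm I = p := by
  obtain ⟨hp, n, hn⟩ := hpd
  have hp0 : (0 : ℤ) < p := by exact_mod_cast hp.pos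
  -- the residue `n mod p ∈ {0, …, p-1}` is a root of `f` modulo `p`
  set n₀ : ℕ := (n % (p : ℤ)).toNat with hn₀
  have hn₀Z : (n₀ : ℤ) = n % (p : ℤ) := Int.toNat_of_nonneg (Int.emod_nonneg _ hp0.ne')
  have hn₀lt : n₀ < p := by have := Int.emod_lt_of_pos n hp0; omega
  have hn₀dvd : (p : ℤ) ∣ f.eval (n₀ : ℤ) := by
    have hsub := sub_dvd_eval_sub (n₀ : ℤ) n f
    have hd : (p : ℤ) ∣ (n₀ : ℤ) - n := by
      rw [hn₀Z, Int.emod_def]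
      exact ⟨-(n / p), by ring⟩
    simpa using dvd_add (hd.trans hsub) hn
  have hcard : 0 < Nat.card {I : Ideal (𝓞 (RootField f)) // Ideal.absNorm I = p} := by
    rw [card_absNorm_eq_card_range_filter f hp hpa hpD]
    exact Finset.card_pos.mpr ⟨n₀, by simp [Finset.mem_filter, hn₀lt, hn₀dvd]⟩
  obtain ⟨⟨I, hI⟩⟩ := (Nat.card_pos_iff.mp hcard).1
  exact ⟨I, hI⟩

/-- **Dedekind's theorem, backward**: if `𝓞 K`, `K = ℚ[X]/(f)`, has an ideal of prime norm
`p ∤ lc(f) · D_f`, then `p` is a prime divisor of `f`. [cite: MurtyThain2006, §2 (proof of Theorem 3)] -/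
theorem isPrimeDivisorOf_of_absNorm_eq {p : ℕ} (hp : p.Prime) (hpa : ¬ p ∣ f.leadingCoeff.natAbs)
    (hpD : ¬ p ∣ (tailDiscr f).natAbs) {I : Ideal (𝓞 (RootField f))}
    (hI : Ideal.absNorm I = p) : IsPrimeDivisorOf f p := by
  haveI : Finite {I : Ideal (𝓞 (RootField f)) // Ideal.absNorm I = p} :=
    (Ideal.finite_setOf_absNorm_eq p).to_subtype
  haveI : Nonempty {I : Ideal (𝓞 (RootField f)) // Ideal.absNorm I = p} := ⟨⟨I, hI⟩⟩
  have hcard : 0 < Nat.card {I : Ideal (𝓞 (RootField f)) // Ideal.absNorm I = p} := Nat.card_pos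
  rw [card_absNorm_eq_card_range_filter f hp hpa hpD] at hcard
  obtain ⟨n₀, hn₀⟩ := Finset.card_pos.mp hcard
  rw [Finset.mem_filter] at hn₀
  exact ⟨hp, n₀, hn₀.2⟩

/-- The finitely many exceptional primes: `p ∣ lc(f)`, `p ∣ D_f` or `p ∣ m`. [folklore] -/
theorem finite_exceptionalPrimes {m : ℕ} (hm : 0 < m) :
    ({p : ℕ | p ∣ f.leadingCoeff.natAbs} ∪ {p : ℕ | p ∣ (tailDiscr f).natAbs} ∪
      {p : ℕ | p ∣ m}).Finite := by
  have ha : 0 < f.leadingCoeff.natAbs :=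
    Int.natAbs_pos.mpr (leadingCoeff_ne_zero.mpr (ne_zero_of_fact_irreducible f))
  have hD : 0 < (tailDiscr f).natAbs := Int.natAbs_pos.mpr (tailDiscr_ne_zero f)
  exact (((Set.finite_Iic _).subset fun _ hp => Nat.le_of_dvd ha hp).union
    ((Set.finite_Iic _).subset fun _ hp => Nat.le_of_dvd hD hp)).union
    ((Set.finite_Iic m).subset fun _ hp => Nat.le_of_dvd hm hp)

end RootField

/-! ### Frobenius elements of `K(ζ_m)/K` at degree-one primes and the class of `p mod m` -/

section Cyclotomic

variable {K N : Type*} [Field K] [NumberField K] [Field N] [Algebra K N] {m : ℕ} [NeZero m]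
  [IsCyclotomicExtension {m} K N]

/-- **The Frobenius of a degree-one prime restricts to `p mod m`.** Let `𝔮 ⊂ 𝓞 K` have prime
norm `p ∤ m`, `𝔔 ∣ 𝔮` a prime of `𝓞 N`, `N = K(ζ_m)`, and `φ ∈ Gal(N/K)` an arithmetic Frobenius
at `𝔔` (`φ x ≡ x^{N𝔮} = x^p (mod 𝔔)`). Then `φ ζ_m = ζ_m^p`, i.e. `φ` restricts to the class of
`p` in `(ℤ/mℤ)ˣ` (Murty–Thain: the degree-one primes of `K` with norm `≡ l (mod k)` "when
restricted to `ℚ(ζ)` reduce to `σ_l`"). [cite: MurtyThain2006, §3 (proof of Theorem 7)] -/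
theorem cast_autToPow_eq_of_isArithFrobAt {p : ℕ} (hp : p.Prime) (hpm : ¬ p ∣ m)
    {q : Ideal (𝓞 K)} (hq : Ideal.absNorm q = p) {Q : Ideal (𝓞 N)} [Q.IsPrime] [Q.LiesOver q]
    {φ : N ≃ₐ[K] N} (hφ : IsArithFrobAt (𝓞 K) φ Q) :
    (((IsCyclotomicExtension.zeta_spec m K N).autToPow K φ : (ZMod m)ˣ) : ZMod m) =
      (p : ZMod m) := by
  set ζ := IsCyclotomicExtension.zeta m K N
  have hζ : IsPrimitiveRoot ζ m := IsCyclotomicExtension.zeta_spec m K N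
  -- `ζ` as an algebraic integer
  set ζ' : 𝓞 N := ⟨ζ, hζ.isIntegral (NeZero.pos m)⟩ with hζ'def
  have hζ'm : ζ' ^ m = 1 := by
    apply RingOfIntegers.ext
    simp only [map_pow, map_one, hζ'def, RingOfIntegers.map_mk]
    exact hζ.pow_eq_one
  -- `q` is a proper ideal containing `p`, hence not containing `m`; so `m ∉ 𝔔`
  have hq1 : q ≠ ⊤ := by
    intro h
    rw [← Ideal.absNorm_eq_one_iff, hq] at h
    exact hp.one_lt.ne' h
  have hpq : (p : 𝓞 K) ∈ q := by
    have := Ideal.absNorm_mem q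
    rwa [hq] at this
  have hmq : (m : 𝓞 K) ∉ q := by
    intro hmq
    have hcop : IsCoprime (p : ℤ) (m : ℤ) :=
      Nat.isCoprime_iff_coprime.mpr ((Nat.Prime.coprime_iff_not_dvd hp).mpr hpm)
    obtain ⟨a, b, hab⟩ := hcop
    apply hq1
    rw [Ideal.eq_top_iff_one]
    have h1 : ((a * p + b * m : ℤ) : 𝓞 K) = 1 := by rw [hab, Int.cast_one]
    rw [← h1]
    push_cast
    exact q.add_mem (q.mul_mem_left _ hpq) (q.mul_mem_left _ hmq)
  have hmQ : (m : 𝓞 N) ∉ Q := by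
    intro hmQ
    apply hmq
    rw [Ideal.mem_of_liesOver Q, map_natCast]
    exact hmQ
  -- the Frobenius congruence is an equality on roots of unity of order prime to `𝔔`
  have hfrob := AlgHom.IsArithFrobAt.apply_of_pow_eq_one hφ hζ'm hmQ
  have hcard : Nat.card (𝓞 K ⧸ Q.under (𝓞 K)) = p := by
    rw [← Ideal.over_def Q q, ← Submodule.cardQuot_apply, ← Ideal.absNorm_apply, hq]
  rw [hcard, MulSemiringAction.toAlgHom_apply] at hfrob
  have hfrobN : φ ζ = ζ ^ p := by
    change ((φ • ζ' : 𝓞 N) : N) = ((ζ' ^ p : 𝓞 N) : N)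
    rw [hfrob]
  -- compare with the defining property of the restriction map, reducing `p` modulo `m`
  have hspec : ζ ^ (((IsCyclotomicExtension.zeta_spec m K N).autToPow K φ : ZMod m)).val = φ ζ :=
    (IsCyclotomicExtension.zeta_spec m K N).autToPow_spec K φ
  rw [hfrobN] at hspec
  have hpmod : ζ ^ p = ζ ^ (p % m) := by
    conv_lhs => rw [← Nat.div_add_mod p m, pow_add, pow_mul, hζ.pow_eq_one, one_pow, one_mul]
  rw [hpmod] at hspec
  have hval : (((IsCyclotomicExtension.zeta_spec m K N).autToPow K φ : ZMod m)).val = p % m :=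
    hζ.pow_inj (ZMod.val_lt _) (Nat.mod_lt _ (NeZero.pos m)) hspec
  rw [← ZMod.natCast_zmod_val ((IsCyclotomicExtension.zeta_spec m K N).autToPow K φ : ZMod m), hval,
    ZMod.natCast_mod]

end Cyclotomic

section Frobenius

variable {K N : Type*} [Field K] [NumberField K] [Field N] [NumberField N] [Algebra K N]
  [IsGalois K N]

/-- Above a nonzero prime `𝔮` of `𝓞 K` there is a prime `𝔔` of `𝓞 N` (`N/K` a Galois extension of
number fields) and an arithmetic Frobenius `φ ∈ Gal(N/K)` at `𝔔` (going up, and the tree's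
`exists_isArithFrobAt_ringOfIntegers`). [folklore] -/
theorem exists_liesOver_isArithFrobAt (q : Ideal (𝓞 K)) [q.IsMaximal] (hq0 : q ≠ ⊥) :
    ∃ Q : Ideal (𝓞 N), Q.IsPrime ∧ Q.LiesOver q ∧ ∃ φ : N ≃ₐ[K] N, IsArithFrobAt (𝓞 K) φ Q := by
  obtain ⟨Q, hQmax, hQ⟩ := Ideal.exists_ideal_over_maximal_of_isIntegral (S := 𝓞 N) q
    (by rw [RingOfIntegers.ker_algebraMap_eq_bot]; exact bot_le)
  haveI : Q.IsPrime := hQmax.isPrime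
  haveI : Q.LiesOver q := ⟨hQ.symm⟩
  have hQ0 : Q ≠ ⊥ := Ideal.ne_bot_of_liesOver_of_ne_bot hq0 Q
  obtain ⟨φ, hφ⟩ :=
    NumberTheory.GaloisRepresentations.exists_isArithFrobAt_ringOfIntegers (M := K) Q hQ0
  exact ⟨Q, inferInstance, inferInstance, φ, hφ⟩

end Frobenius

/-! ### `S(f, m)` is the image of `Gal(K(ζ_m)/K)` in `(ℤ/mℤ)ˣ` -/

section Main

variable {f : ℤ[X]}

/-- **`S(f, m)` lies in the image of `Gal(K(ζ_m)/K) → (ℤ/mℤ)ˣ` (unconditional half of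
Pollack's Theorem 2 / Conrad's Theorem 4).** For `f ∈ ℤ[X]` irreducible over `ℚ`,
`K = ℚ[X]/(f)`, every class `mod m` containing infinitely many prime divisors of `f` is the
restriction to `ℚ(ζ_m)` of an element of `Gal(K(ζ_m)/K)`: a large prime divisor `p` lies below a
degree-one prime `𝔮` of `K` (Dedekind), and the Frobenius of a prime of `K(ζ_m)` above `𝔮`
restricts to `p mod m`. [cite: MurtyThain2006, §3 (proof of Theorem 7)] [cite: Pollack2010MurtyH, §3 Theorem 2] -/
theorem primeDivisorClasses_subset_image [Fact (Irreducible (f.map (algebraMap ℤ ℚ)))] {m : ℕ}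
    [NeZero m] :
    primeDivisorClasses f m ⊆ ((↑) : (ZMod m)ˣ → ZMod m) ''
      (((IsCyclotomicExtension.zeta_spec m (RootField f) (CyclotomicField m (RootField f))).autToPow
        (RootField f)).range : Set (ZMod m)ˣ) := by
  set K := RootField f
  set N := CyclotomicField m K
  haveI : IsGalois K N := IsCyclotomicExtension.isGalois {m} K N
  intro b hb
  -- a good prime divisor in the class `b`
  obtain ⟨p, ⟨hpd, hpb⟩, hpgood⟩ :=
    (((mem_primeDivisorClasses_iff f m b).mp hb).sdiff
      (finite_exceptionalPrimes f (NeZero.pos m))).nonempty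
  simp only [Set.mem_union, Set.mem_setOf_eq, not_or] at hpgood
  obtain ⟨⟨hpa, hpD⟩, hpm⟩ := hpgood
  have hp : p.Prime := hpd.1
  -- a degree-one prime `I` of `K` above `p`, a prime `Q` of `N` above `I` and its Frobenius
  obtain ⟨I, hI⟩ := exists_absNorm_eq_of_isPrimeDivisorOf f hpa hpD hpd
  have hIprime : I.IsPrime :=
    Ideal.isPrime_of_irreducible_absNorm (hI ▸ (Nat.irreducible_iff_nat_prime p).mpr hp)
  have hI0 : I ≠ ⊥ := fun h => hp.ne_zero (by rw [← hI, Ideal.absNorm_eq_zero_iff]; exact h)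
  haveI : I.IsMaximal := hIprime.isMaximal hI0
  obtain ⟨Q, hQp, hQover, φ, hφ⟩ := exists_liesOver_isArithFrobAt (K := K) (N := N) I hI0
  have hclass := cast_autToPow_eq_of_isArithFrobAt (m := m) hp hpm hI hφ
  exact ⟨(IsCyclotomicExtension.zeta_spec m K N).autToPow K φ, ⟨φ, rfl⟩, by rw [hclass, hpb]⟩

/-- **The image of `Gal(K(ζ_m)/K)` lies in `S(f, m)`, granted Chebotarev's theorem for
`K(ζ_m)/K`** (the other half of Pollack's Theorem 2 / Conrad's Theorem 4, exactly as in
Murty–Thain's proof of Theorem 7: "there are infinitely many prime ideals of `K` of degree one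
whose Frobenius automorphism restricts to any given element"; such a prime of norm
`p ∤ lc(f) D_f m` makes `p` a prime divisor of `f` (Dedekind), with `p ≡` the restriction
`(mod m)`). [cite: MurtyThain2006, §3 (proof of Theorem 7)] -/
theorem image_subset_primeDivisorClasses
    (hC : NumberTheory.GaloisRepresentations.chebotarev_cyclotomicExtension)
    [Fact (Irreducible (f.map (algebraMap ℤ ℚ)))] {m : ℕ} [NeZero m] :
    ((↑) : (ZMod m)ˣ → ZMod m) ''
      (((IsCyclotomicExtension.zeta_spec m (RootField f) (CyclotomicField m (RootField f))).autToPow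
        (RootField f)).range : Set (ZMod m)ˣ) ⊆ primeDivisorClasses f m := by
  set K := RootField f
  set N := CyclotomicField m K
  haveI : IsGalois K N := IsCyclotomicExtension.isGalois {m} K N
  rintro _ ⟨u, ⟨τ, rfl⟩, rfl⟩
  rw [mem_primeDivisorClasses_iff]
  -- Chebotarev: infinitely many degree-one primes `𝔮` of `K` with Frobenius `τ` in `N/K`
  have hT := hC K N m τ
  set T := {q : IsDedekindDomain.HeightOneSpectrum (𝓞 K) | (Ideal.absNorm q.asIdeal).Prime ∧
    Algebra.IsUnramifiedIn (𝓞 N) q.asIdeal ∧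
    ∀ Q ∈ q.asIdeal.primesOver (𝓞 N), ∀ φ : N ≃ₐ[K] N, IsArithFrobAt (𝓞 K) φ Q → φ = τ}
  -- the set of primes `p = N𝔮`, `𝔮 ∈ T`, is infinite (finitely many `𝔮` have a given norm)
  set P : Set ℕ :=
    (fun q : IsDedekindDomain.HeightOneSpectrum (𝓞 K) => Ideal.absNorm q.asIdeal) '' T
  have hPinf : P.Infinite := by
    intro hPfin
    apply hT
    have hfib : ∀ p : ℕ,
        {q : IsDedekindDomain.HeightOneSpectrum (𝓞 K) | Ideal.absNorm q.asIdeal = p}.Finite :=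
      fun p => (Ideal.finite_setOf_absNorm_eq p).preimage
        fun _ _ _ _ h => IsDedekindDomain.HeightOneSpectrum.ext h
    refine (hPfin.biUnion fun p _ => hfib p).subset fun q hq => ?_
    simp only [Set.mem_iUnion, Set.mem_setOf_eq]
    exact ⟨_, ⟨q, hq, rfl⟩, rfl⟩
  refine (hPinf.sdiff (finite_exceptionalPrimes f (NeZero.pos m))).mono ?_
  rintro p ⟨⟨q, hq, rfl⟩, hpgood⟩
  simp only [Set.mem_union, Set.mem_setOf_eq, not_or] at hpgood
  obtain ⟨⟨hpa, hpD⟩, hpm⟩ := hpgood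
  obtain ⟨hp, -, hfrob⟩ := hq
  refine ⟨isPrimeDivisorOf_of_absNorm_eq f hp hpa hpD rfl, ?_⟩
  -- every Frobenius above `𝔮` is `τ`, and it restricts to `p mod m`
  haveI : q.asIdeal.IsMaximal := q.isMaximal
  obtain ⟨Q, hQp, hQover, φ, hφ⟩ :=
    exists_liesOver_isArithFrobAt (K := K) (N := N) q.asIdeal q.ne_bot
  have hφτ : φ = τ := hfrob Q ⟨hQp, hQover⟩ φ hφ
  have hclass := cast_autToPow_eq_of_isArithFrobAt (m := m) hp hpm rfl hφ
  rw [hφτ] at hclass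
  exact hclass.symm

/-- **Pollack's Theorem 2 / Conrad's Theorem 4 in Murty–Thain's form, granted Chebotarev for
`K(ζ_m)/K`:** for `f` irreducible over `ℚ`, `S(f, m)` is exactly the image of
`Gal(K(ζ_m)/K) → (ℤ/mℤ)ˣ`, `K = ℚ[X]/(f)`.
[cite: MurtyThain2006, §3 (proof of Theorem 7)] [cite: Pollack2010MurtyH, §3 Theorem 2] -/
theorem primeDivisorClasses_eq_image
    (hC : NumberTheory.GaloisRepresentations.chebotarev_cyclotomicExtension)
    [Fact (Irreducible (f.map (algebraMap ℤ ℚ)))] {m : ℕ} [NeZero m] :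
    primeDivisorClasses f m = ((↑) : (ZMod m)ˣ → ZMod m) ''
      (((IsCyclotomicExtension.zeta_spec m (RootField f) (CyclotomicField m (RootField f))).autToPow
        (RootField f)).range : Set (ZMod m)ˣ) :=
  Set.Subset.antisymm primeDivisorClasses_subset_image (image_subset_primeDivisorClasses hC)

end Main

/-! ### Murty's theorem from Chebotarev's theorem for cyclotomic extensions -/

/-- **The subgroup fact `PrimeDivisorClassesSubgroup` from Chebotarev's theorem for `K(ζ_m)/K`**
(the tree's named fact
`Literature.NumberTheory.GaloisRepresentations.chebotarev_cyclotomicExtension`, degree-one existence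
form — exactly the input of Murty–Thain's proof): take `H =` the image of
`Gal(K(ζ_m)/K)`, `K = ℚ[X]/(f)`. [cite: MurtyThain2006, §3 Theorem 7 (proof)] [cite: Pollack2010MurtyH, §3 Theorem 2] -/
theorem primeDivisorClassesSubgroup_of_chebotarev
    (hC : NumberTheory.GaloisRepresentations.chebotarev_cyclotomicExtension) :
    PrimeDivisorClassesSubgroup := by
  intro m f hm _ hirr
  haveI : NeZero m := ⟨hm.ne'⟩
  haveI : Fact (Irreducible (f.map (algebraMap ℤ ℚ))) :=
    ⟨by rwa [show algebraMap ℤ ℚ = Int.castRingHom ℚ from RingHom.ext_int _ _]⟩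
  exact ⟨_, primeDivisorClasses_eq_image hC⟩

/-- **Murty's impossibility theorem (`EuclideanProofBarrier`), granted Chebotarev's density
theorem for the cyclotomic extensions `K(ζ_m)/K`** — the architecture of Murty–Thain 2006,
Theorem 7: Chebotarev gives `S(f, m) =` the image of `Gal(K(ζ_m)/K)`, a subgroup
(`primeDivisorClassesSubgroup_of_chebotarev`), and an `E`-polynomial has an irreducible factor
that is an `E`-polynomial, whose `S(f, m)` is sandwiched between `{a}` and `{1, a}`
(`euclideanProofBarrier_of_subgroup`), whence `a² ≡ 1 (mod m)`. The only input not proved in the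
tree is the named fact `chebotarev_cyclotomicExtension`.
[cite: MurtyThain2006, Theorem 1 and §3 Theorem 7] [cite: Pollack2010MurtyH, §1.1 and §3] -/
theorem euclideanProofBarrier_of_chebotarev
    (hC : NumberTheory.GaloisRepresentations.chebotarev_cyclotomicExtension) :
    EuclideanProofBarrier :=
  euclideanProofBarrier_of_subgroup (primeDivisorClassesSubgroup_of_chebotarev hC)

/-! ### The unconditional discharges -/

/-- **Chebotarev's density theorem for `K(ζ_m)/K` (degree-one existence form) holds**: the tree's
Dirichlet-type reduction `chebotarev_cyclotomicExtension_of_rayClassLSeries_tendsto`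
(`GaloisRepresentations/CyclotomicDirichletDensity.lean`) fed with the proved regularity of ray
class `L`-series at `s = 1`, `Literature.NumberTheory.LFunctions.rayClassLSeries_tendsto_nhdsGT_one_holds`
(Heilbronn's (b), `LFunctions/RayClassLSeriesAtOneLimitProofs.lean`).  A local composition (the
named fact lives in `GaloisRepresentations/ChebotarevCyclotomic.lean`).
[cite: HeilbronnZetaL1967, §2 Note after Theorem 5 (b) and footnote PDF p. 253] -/
theorem chebotarev_cyclotomicExtension_of_holds :
    NumberTheory.GaloisRepresentations.chebotarev_cyclotomicExtension :=
  NumberTheory.GaloisRepresentations.chebotarev_cyclotomicExtension_of_rayClassLSeries_tendsto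
    fun K _ _ => NumberTheory.LFunctions.rayClassLSeries_tendsto_nhdsGT_one_holds (K := K)

/-- **Pollack's Theorem 2 / Conrad's Theorem 4, PROVED unconditionally**: for a non-constant
`f ∈ ℤ[X]` irreducible over `ℚ` and `m ≥ 1`, the set `S(f, m)` of classes `mod m` containing
infinitely many prime divisors of `f` is the image of a subgroup of `(ℤ/mℤ)ˣ` (namely of
`Gal(K(ζ_m)/K) ↪ (ℤ/mℤ)ˣ`, `K = ℚ[X]/(f)`).  Discharge of the named fact
`PrimeDivisorClassesSubgroup` of `EuclideanProofs.lean`: `primeDivisorClassesSubgroup_of_chebotarev`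
applied to the proved Chebotarev theorem for cyclotomic extensions.
[cite: Pollack2010MurtyH, §3 Theorem 2] [cite: ConradEuclideanDirichlet, Theorem 4] [cite: MurtyThain2006, §3 Theorem 7 (proof)] -/
theorem PrimeDivisorClassesSubgroup_holds : PrimeDivisorClassesSubgroup :=
  primeDivisorClassesSubgroup_of_chebotarev chebotarev_cyclotomicExtension_of_holds

/-- **Murty's impossibility theorem for Euclidean proofs of Dirichlet's theorem, PROVED
unconditionally** (Murty 1988; Murty–Thain 2006, Theorem 1 "only if" / §3 Theorem 7: "Suppose that
with finitely many exceptions, all prime divisors of `f` are either `≡ 1` or `l (mod k)` [and, by the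
definition of a Euclidean proof, infinitely many are `≡ l`]. Then `l² ≡ 1 (mod k)`"): there is no
`E`-polynomial for the progression `a mod m` unless `a² ≡ 1 (mod m)`.  Discharge of the catalogue
fact `EuclideanProofBarrier` of `EuclideanProofs.lean`, along the printed architecture
(`euclideanProofBarrier_of_chebotarev`: Dedekind + Chebotarev for `K(ζ_m)/K` + the subgroup sandwich),
with Chebotarev's theorem now proved in the tree (Frobenius elements of `K(ζ_m)/K`, Dirichlet's
argument over `K`, Heilbronn's (b) from Weber's estimate).
[cite: MurtyThain2006, Theorem 1 and §3 Theorem 7] [cite: Pollack2010MurtyH, §1.1 and §3] [cite: ConradEuclideanDirichlet, Theorem 2] -/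
theorem EuclideanProofBarrier_holds : EuclideanProofBarrier :=
  euclideanProofBarrier_of_chebotarev chebotarev_cyclotomicExtension_of_holds

end Literature.Barriers.Parity
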